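import Summits.BirchSwinnertonDyer.BirchSwinnertonDyer.Theorems.AdditiveBranchIMCGordTwoTwistedWanDefs
import Summits.BirchSwinnertonDyer.BirchSwinnertonDyer.Theorems.AdditiveBranchIMCTwistRootNumberTwistedPosAnyTwo
import Summits.BirchSwinnertonDyer.BirchSwinnertonDyer.Theorems.AdditiveBranchIMCTwistRootNumberTwistedClassArith
import Summits.BirchSwinnertonDyer.BirchSwinnertonDyer.Theorems.AdditiveBranchIMCGordTwoRankZeroOffCaseOneFieldSupplyTwoR0Aux
import Literature.NumberTheory.EllipticCurves.NonvanishingTwistsProofs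
import Literature.NumberTheory.EllipticCurves.NonvanishingTwistsPrescribedSplitting
import Summits.BirchSwinnertonDyer.BirchSwinnertonDyer.Theorems.AdditiveBranchIMCGordTwoTwistedLooseDefs
import HarnessLib

/-!
# LOOSE VARIANT (LEAD g18, door C «loose SU prime» of LeadReport26 §4 / LeadReport27 §4.2; crux 19357 `three_field_road` and the pen's r₁ twin 19358):
# the rank-one field-one supply `AdditiveBranchIMCGordTwoTwistedFieldOneAnyTwo.lean` (LEAD g18, p816601; Friedberg–Hoffstein via Hoffstein–Luo) VERBATIM with the field hypothesis `TameRoadFieldTwisted W p q K` REPLACED by `TameRoadFieldTwistedLoose W p q K`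
# (`AdditiveBranchIMCGordTwoTwistedLooseDefs.lean`, p816632: the twisted Wan prime WITHOUT Skinner–Urban's clause `p ∤ v_q(j)`). 
# * `fieldOneTwisted_of_fh_loose`.
# Theorems only (no definition, no named fact, no `sorry`); `--supports` 19357, helper only; 19357 / 19358 stay OPEN; BSD is proved for no curve.
-/

set_option linter.dupNamespace false
set_option autoImplicit false

noncomputable section

open scoped Classical

open WeierstrassCurve IsDedekindDomain NumberField Rat.HeightOneSpectrum
  Literature.NumberTheory.EllipticCurves Literature.NumberTheory.EllipticCurves.ModularForms
  Literature.NumberTheory.EllipticCurves.Rank1Residual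
  Summit.BirchSwinnertonDyer.BirchSwinnertonDyer.Theorems

namespace Summit.BirchSwinnertonDyer.BirchSwinnertonDyer.Theorems.TwistedWanRoad

open NumberTheorySymbols

/-- `(a / b) = 1` forces `gcd(a, b) = 1`. [folklore] -/
private theorem isCoprime_of_jacobiSym_eq_one {a : ℤ} {b : ℕ} (hb : b ≠ 0) (h : jacobiSym a b = 1) :
    IsCoprime a (b : ℤ) := by
  refine Int.isCoprime_iff_gcd_eq_one.mpr ?_
  by_contra hg
  rw [jacobiSym.eq_zero_iff.mpr ⟨hb, hg⟩] at h
  exact zero_ne_one h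

/-- `(a / b) = 1` forces `b ∤ a` (`b > 1`). [folklore] -/
private theorem not_dvd_of_jacobiSym_eq_one {a : ℤ} {b : ℕ} (hb : 1 < b) (h : jacobiSym a b = 1) : ¬ (b : ℤ) ∣ a := by
  intro hdvd
  have h0 : jacobiSym a b = 0 := by
    rw [jacobiSym.mod_left, Int.emod_eq_zero_of_dvd hdvd, jacobiSym.zero_left hb]
  rw [h0] at h
  exact zero_ne_one h

/-- The Jacobi symbol of `±ℓ` at an odd prime `r ≠ ℓ` is `±1`. [folklore] -/
private theorem jacobiSym_pStar_eq_one_or {ℓ r : ℕ} (hℓ : ℓ.Prime) (hr : r.Prime) (hrℓ : r ≠ ℓ) :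
    J((-1 : ℤ) ^ (ℓ / 2) * ℓ | r) = 1 ∨ J((-1 : ℤ) ^ (ℓ / 2) * ℓ | r) = -1 := by
  refine jacobiSym.eq_one_or_neg_one ?_
  have hc : IsCoprime ((r : ℕ) : ℤ) ((-1 : ℤ) ^ (ℓ / 2) * ℓ) := by
    refine (Prime.coprime_iff_not_dvd (Nat.prime_iff_prime_int.mp hr)).mpr fun h ↦ ?_
    have h' : (r : ℤ) ∣ (ℓ : ℤ) := ((isUnit_neg_one (α := ℤ)).pow _).dvd_mul_left.mp h
    exact hrℓ ((Nat.prime_dvd_prime_iff_eq hr hℓ).mp (Int.natCast_dvd_natCast.mp h'))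
  exact Int.isCoprime_iff_gcd_eq_one.mp hc.symm

/-- **The rank-one field-one supply of the twisted road, from Friedberg–Hoffstein's prescribed-splitting non-vanishing instance, any twist-type
reduction at `2`** (`FieldOneTwistedCutOne` with its dyadic binder replaced by the twist-type clause; road as in the rank-zero sibling). [cite: FriedbergHoffstein1995, Thm. B]
[cite: JetchevSkinnerWan2017, §7.4.2 (p. 31)] [cite: SilvermanAEC2009, X.5 Cor. 5.4 and Ex. 10.16] -/
theorem fieldOneTwisted_of_fh_loose (hFH : friedbergHoffstein_exists_heegnerField_splitDivisors_twist_ne_zero) :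
    ∀ (W : WeierstrassCurve ℚ) [W.IsElliptic] [W.IsGloballyMinimal], exists_isNewformOf →
    (∀ r : Nat.Primes, (r : ℕ) ≠ 2 → W.HasAdditiveReductionAt ((primesEquiv (R := ℤ)).symm r) →
      ¬ (W.quadraticTwist (((-1 : ℤ) ^ ((r : ℕ) / 2) * r : ℤ) : ℚ)).HasAdditiveReductionAt
        ((primesEquiv (R := ℤ)).symm r)) →
    (∀ r : Nat.Primes, (r : ℕ) = 2 → W.HasAdditiveReductionAt ((primesEquiv (R := ℤ)).symm r) →
      ∃ t : ℤ, (t = -1 ∨ t = 2 ∨ t = -2) ∧ ¬ (W.quadraticTwist (t : ℚ)).HasAdditiveReductionAt ((primesEquiv (R := ℤ)).symm r)) →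
    W.rootNumber = -1 →
    ∀ (p ℓ : ℕ) [Fact ℓ.Prime], p.Prime → p ≠ 2 → TwistedWanPrimeLoose W p ℓ → ∀ B : ℕ,
      ∃ (K : Type) (_ : Field K) (_ : NumberField K),
        TameRoadFieldTwistedLoose W p ℓ K ∧ B < (NumberField.discr K).natAbs ∧
          (W.quadraticTwist (NumberField.discr K : ℚ)).entireLFunction 1 ≠ 0 := by
  intro W _ _ hmod htt h2tt hw p ℓ₀ hℓ₀F hp hp2 htw B
  obtain ⟨hℓ₀p, hℓ₀2, hadd₀, hmult₀⟩ := htw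
  have hℓ₀ : ℓ₀.Prime := hℓ₀F.out
  set N : ℕ := W.conductorNorm ℤ with hN
  have hN0 : N ≠ 0 := (W.conductorNorm_pos_holds).ne'
  -- `ℓ₀* = σ ℓ₀`
  set σ : ℤ := (-1 : ℤ) ^ (ℓ₀ / 2) with hσdef
  set s : ℤ := (-1 : ℤ) ^ (ℓ₀ / 2) * ℓ₀ with hs
  have hσ : σ = 1 ∨ σ = -1 := neg_one_pow_eq_or ℤ _
  have hσ2 : σ * σ = 1 := by rcases hσ with h | h <;> simp [h]
  have hs4 : s % 4 = 1 := TwistRootNumberAnyTwo.pStar_emod_four ⟨ℓ₀, hℓ₀⟩ hℓ₀2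
  have hs0 : s ≠ 0 := mul_ne_zero (pow_ne_zero _ (by norm_num)) (by exact_mod_cast hℓ₀.ne_zero)
  have hps : (primeStar ℓ₀ : ℤ) = s := rfl
  -- the class sign
  set c : ℤ := (if (W.quadraticTwist (((-1 : ℤ) ^ (ℓ₀ / 2) * ℓ₀ : ℤ) : ℚ)).HasSplitMultiplicativeReductionAtPrime ℓ₀ then -1 else 1)
    with hc
  have hc1 : c = 1 ∨ c = -1 := by
    by_cases h : (W.quadraticTwist (((-1 : ℤ) ^ (ℓ₀ / 2) * ℓ₀ : ℤ) : ℚ)).HasSplitMultiplicativeReductionAtPrime ℓ₀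
    · exact Or.inr (by rw [hc, if_pos h])
    · exact Or.inl (by rw [hc, if_neg h])
  -- the set of odd primes at which the Dirichlet prime is prescribed, and the prescription
  set S : Finset ℕ := insert ℓ₀ (insert p ((N.primeFactors.erase 2).erase ℓ₀)) with hSdef
  set η : ℕ → ℤ := fun r ↦ if r = ℓ₀ then c else J(s | r) with hη
  have hSodd : ∀ r ∈ S, r.Prime ∧ r ≠ 2 := by
    intro r hr
    rw [hSdef, Finset.mem_insert, Finset.mem_insert] at hr
    rcases hr with rfl | rfl | hr
    · exact ⟨hℓ₀, hℓ₀2⟩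
    · exact ⟨hp, hp2⟩
    · obtain ⟨-, hr⟩ := Finset.mem_erase.mp hr
      obtain ⟨hr2, hr⟩ := Finset.mem_erase.mp hr
      exact ⟨(Nat.mem_primeFactors.mp hr).1, hr2⟩
  have hηpm : ∀ r ∈ S, η r = 1 ∨ η r = -1 := by
    intro r hr
    by_cases hrℓ : r = ℓ₀
    · simp only [hη, if_pos hrℓ]; exact hc1
    · simp only [hη, if_neg hrℓ]
      exact jacobiSym_pStar_eq_one_or hℓ₀ (hSodd r hr).1 hrℓ
  -- the Dirichlet prime `a`
  obtain ⟨a, ha, haB, hσa, h8, hJ⟩ :=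
    WanAnyRoad.exists_prime_star_prescribed_of_emod_four hs4 hσ S hSodd η hηpm (N + p + ℓ₀ + 2)
  haveI haF : Fact a.Prime := ⟨ha⟩
  set as : ℤ := (-1 : ℤ) ^ (a / 2) * a with has
  have haℓ : a ≠ ℓ₀ := by omega
  have hap : a ≠ p := by omega
  have ha2 : a ≠ 2 := by omega
  have haN : ¬ a ∣ N := fun h ↦ by have := Nat.le_of_dvd (Nat.pos_of_ne_zero hN0) h; omega
  have hagood : W.HasGoodReductionAtPrime a := by
    by_contra h; exact haN ((W.dvd_conductorNorm_iff_not_hasGoodReductionAtPrime a).mpr h)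
  have has_eq : as = σ * a := by rw [has, hσa]
  have hs_eq : s = σ * ℓ₀ := by rw [hs]
  -- the prescriptions read back
  have hJℓ₀ : J(as | ℓ₀) = c := by
    have h := hJ ℓ₀ (by rw [hSdef]; exact Finset.mem_insert_self _ _)
    simp only [hη, if_pos rfl] at h
    exact h
  have hJp : J(as | p) = J(s | p) := by
    have h := hJ p (by rw [hSdef]; exact Finset.mem_insert_of_mem (Finset.mem_insert_self _ _))
    simp only [hη, if_neg (Ne.symm hℓ₀p)] at h
    exact h
  have hJbad : ∀ r : ℕ, r.Prime → r ∣ N → r ≠ 2 → r ≠ ℓ₀ → J(as | r) = J(s | r) := by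
    intro r hr hrN hr2 hrℓ
    have hmem : r ∈ S := by
      rw [hSdef]
      refine Finset.mem_insert_of_mem (Finset.mem_insert_of_mem ?_)
      exact Finset.mem_erase.mpr ⟨hrℓ, Finset.mem_erase.mpr ⟨hr2, Nat.mem_primeFactors.mpr ⟨hr, hrN, hN0⟩⟩⟩
    have h := hJ r hmem
    simp only [hη, if_neg hrℓ] at h
    exact h
  have hJsq : ∀ r : ℕ, r.Prime → r ≠ ℓ₀ → J(s | r) * J(s | r) = 1 := by
    intro r hr hrℓ
    rcases jacobiSym_pStar_eq_one_or hℓ₀ hr hrℓ with h | h <;> rw [h] <;> norm_num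
  -- §1 the auxiliary twist `E'' = E^{(D₀)}`, `D₀ = ℓ₀*·a* = ℓ₀ a > 0`
  set D₀ : ℤ := s * as with hD₀
  have hD₀eq : D₀ = (ℓ₀ : ℤ) * a := by
    rw [hD₀, hs_eq, has_eq]
    linear_combination ((ℓ₀ : ℤ) * a) * hσ2
  have hD₀pos : 0 < D₀ := by rw [hD₀eq]; exact mul_pos (by exact_mod_cast hℓ₀.pos) (by exact_mod_cast ha.pos)
  have hD₀0 : D₀ ≠ 0 := hD₀pos.ne'
  have hDm₀ : D₀ = (-1 : ℤ) ^ (ℓ₀ / 2) * ℓ₀ * as := by rw [hD₀, hs]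
  have h8₀ : D₀ % 8 = 1 := by rw [hD₀, has]; exact h8
  have hasabs : as.natAbs = a := by
    rw [has, Int.natAbs_mul, Int.natAbs_pow, Int.natAbs_neg, Int.natAbs_one, one_pow, one_mul, Int.natAbs_natCast]
  have hmsq₀ : Squarefree as := Int.squarefree_natAbs.mp (by rw [hasabs]; exact ha.prime.squarefree)
  have hℓ₀as : ¬ (ℓ₀ : ℤ) ∣ as := by
    intro h
    have h' : ℓ₀ ∣ as.natAbs := Int.natCast_dvd.mp h
    rw [hasabs] at h'
    exact haℓ ((Nat.prime_dvd_prime_iff_eq hℓ₀ ha).mp h').symm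
  have hgood₀ : ∀ r : Nat.Primes, ((r : ℕ) : ℤ) ∣ as → W.HasGoodReductionAt ((primesEquiv (R := ℤ)).symm r) := by
    intro r hr
    have h' : (r : ℕ) ∣ as.natAbs := Int.natCast_dvd.mp hr
    rw [hasabs] at h'
    have hra : (r : ℕ) = a := (Nat.prime_dvd_prime_iff_eq r.2 ha).mp h'
    have : r = ⟨a, ha⟩ := Subtype.ext hra
    subst this
    exact (W.hasGoodReductionAtPrime_iff_hasGoodReductionAt_holds ⟨a, ha⟩).mp hagood
  have hjac₀ : ∀ r : ℕ, r.Prime → r ∣ W.conductorNorm ℤ → r ≠ 2 → r ≠ ℓ₀ → jacobiSym D₀ r = 1 := by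
    intro r hr hrN hr2 hrℓ
    rw [hD₀, jacobiSym.mul_left, hJbad r hr hrN hr2 hrℓ, hJsq r hr hrℓ]
  -- `E''` is NON-SPLIT at `ℓ₀` (the class of `a`), hence `w(E'') = w(E) = −1`
  have hD₀Q : (D₀ : ℚ) ≠ 0 := by exact_mod_cast hD₀0
  haveI := W.isElliptic_quadraticTwist hD₀Q
  have hnsD₀ : ¬ (W.quadraticTwist (D₀ : ℚ)).HasSplitMultiplicativeReductionAtPrime ℓ₀ := by
    obtain ⟨V, iV, iVm, CV, hCV⟩ := exists_isGloballyMinimal_smul_eq_quadraticTwist W hD₀Q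
    have hV : CV⁻¹ • W.quadraticTwist (D₀ : ℚ) = V := by rw [← hCV, inv_smul_smul]
    have hclass₀ : legendreSym ℓ₀ as = c := by
      rw [jacobiSym.legendreSym.to_jacobiSym]; exact hJℓ₀
    obtain ⟨-, hnsV⟩ := TwistRootNumberTwisted.quadraticTwist_nonsplit_at_of_class W hℓ₀2 hmult₀ hDm₀ hℓ₀as hclass₀ V ⟨CV⁻¹, hV⟩
    rw [← hCV, hasSplitMultiplicativeReductionAtPrime_smul_iff]
    exact hnsV
  have hw₀ : (W.quadraticTwist (D₀ : ℚ)).rootNumber = -1 := by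
    rw [TwistRootNumberTwisted.rootNumber_quadraticTwist_eq_of_potMult_nonsplit_pos_anyTwo W hmod htt h2tt hℓ₀2 hadd₀ hmult₀ hDm₀ h8₀
      hD₀pos hmsq₀ hℓ₀as hgood₀ hjac₀ hnsD₀]
    exact hw
  -- §2 Friedberg–Hoffstein's prescribed-splitting instance for `E''` with the primes of `2·p·a·ℓ₀·N` split
  set M : ℕ := ∏ i ∈ (N.primeFactors.erase 2).erase ℓ₀, i with hM
  have hM0 : M ≠ 0 := Finset.prod_ne_zero_iff.mpr fun i hi ↦
    (Nat.mem_primeFactors.mp (Finset.mem_erase.mp (Finset.mem_erase.mp hi).2).2).1.ne_zero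
  have hMdvd : ∀ r : ℕ, r.Prime → r ∣ N → r ≠ 2 → r ≠ ℓ₀ → r ∣ M := fun r hr hrN hr2 hrℓ ↦
    Finset.dvd_prod_of_mem (fun i ↦ i)
      (Finset.mem_erase.mpr ⟨hrℓ, Finset.mem_erase.mpr ⟨hr2, Nat.mem_primeFactors.mpr ⟨hr, hrN, hN0⟩⟩⟩)
  have hMmem : ∀ r : ℕ, r.Prime → r ∣ M → r ∣ N ∧ r ≠ 2 ∧ r ≠ ℓ₀ := by
    intro r hr h
    obtain ⟨i, hi, hri⟩ := ((Nat.Prime.prime hr).dvd_finsetProd_iff (fun i ↦ i)).mp h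
    obtain ⟨hiℓ, hi⟩ := Finset.mem_erase.mp hi
    obtain ⟨hi2, hiN⟩ := Finset.mem_erase.mp hi
    have hip := Nat.mem_primeFactors.mp hiN
    have hri' : r = i := (Nat.prime_dvd_prime_iff_eq hr hip.1).mp hri
    subst hri'
    exact ⟨hip.2.1, hi2, hiℓ⟩
  set N₂ : ℕ := 2 * p * a * ℓ₀ * M with hN₂
  have hN₂0 : N₂ ≠ 0 := by
    rw [hN₂]; exact mul_ne_zero (mul_ne_zero (mul_ne_zero (mul_ne_zero two_ne_zero hp.ne_zero) ha.ne_zero) hℓ₀.ne_zero) hM0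
  obtain ⟨K₁, iF₁, iN₁, hK₁, hB₁, -, hH₂, hL1⟩ := hFH (W.quadraticTwist (D₀ : ℚ)) hw₀ N₂ hN₂0 (B + 4)
  obtain ⟨d₁, hd₁neg, hfund₁, hBd₁, hkr₁, hL1₁⟩ :=
    (exists_heegnerField_iff_exists_fundamental N₂ (B + 4)
      (fun D ↦ ((W.quadraticTwist (D₀ : ℚ)).quadraticTwist (D : ℚ)).entireLFunction 1 ≠ 0)).mp
      ⟨K₁, iF₁, iN₁, hK₁, hB₁, hH₂, hL1⟩
  have hdvdN₂ : ∀ r : ℕ, r = 2 ∨ r = p ∨ r = a ∨ r = ℓ₀ → r ∣ N₂ := by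
    rintro r (rfl | rfl | rfl | rfl)
    · exact ⟨p * a * ℓ₀ * M, by rw [hN₂]; ring⟩
    · exact ⟨2 * a * ℓ₀ * M, by rw [hN₂]; ring⟩
    · exact ⟨2 * p * ℓ₀ * M, by rw [hN₂]; ring⟩
    · exact ⟨2 * p * a * M, by rw [hN₂]; ring⟩
  have hd₁8 : d₁ % 8 = 1 := (hkr₁ 2 Nat.prime_two (hdvdN₂ 2 (Or.inl rfl))).1 rfl
  have hsq₁ : Squarefree d₁ := by
    rcases hfund₁ with ⟨-, h, -⟩ | ⟨h4, -, -⟩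
    · exact h
    · exfalso; omega
  have hdℓ₀ : jacobiSym d₁ ℓ₀ = 1 := (hkr₁ ℓ₀ hℓ₀ (hdvdN₂ ℓ₀ (Or.inr (Or.inr (Or.inr rfl))))).2 hℓ₀2
  have hda : jacobiSym d₁ a = 1 := (hkr₁ a ha (hdvdN₂ a (Or.inr (Or.inr (Or.inl rfl))))).2 ha2
  have hdp : jacobiSym d₁ p = 1 := (hkr₁ p hp (hdvdN₂ p (Or.inr (Or.inl rfl)))).2 hp2
  have hdbad : ∀ r : ℕ, r.Prime → r ∣ N → r ≠ 2 → r ≠ ℓ₀ → jacobiSym d₁ r = 1 := fun r hr hrN hr2 hrℓ ↦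
    (hkr₁ r hr ((hMdvd r hr hrN hr2 hrℓ).trans ⟨2 * p * a * ℓ₀, by rw [hN₂]; ring⟩)).2 hr2
  -- §3 the discriminant `D = D₀ d₁ = ℓ₀* (a* d₁)`: odd, negative, fundamental
  set D : ℤ := D₀ * d₁ with hDdef
  have hDneg : D < 0 := by rw [hDdef]; exact mul_neg_of_pos_of_neg hD₀pos hd₁neg
  have hD8 : D % 8 = 1 := by rw [hDdef, Int.mul_emod, h8₀, hd₁8]; norm_num
  have hD4 : D % 4 = 1 := by omega
  have hd₁abs_lt : B + 4 < d₁.natAbs := hBd₁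
  have hDabs : D.natAbs = ℓ₀ * a * d₁.natAbs := by
    rw [hDdef, hD₀eq, Int.natAbs_mul, Int.natAbs_mul, Int.natAbs_natCast, Int.natAbs_natCast]
  have hBD : B + 4 < D.natAbs := by
    rw [hDabs]
    exact lt_of_lt_of_le hd₁abs_lt (Nat.le_mul_of_pos_left _ (Nat.pos_of_ne_zero (mul_ne_zero hℓ₀.ne_zero ha.ne_zero)))
  have hℓ₀d₁ : ¬ ℓ₀ ∣ d₁.natAbs := fun h ↦ not_dvd_of_jacobiSym_eq_one hℓ₀.one_lt hdℓ₀ (Int.natCast_dvd.mpr h)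
  have had₁ : ¬ a ∣ d₁.natAbs := fun h ↦ not_dvd_of_jacobiSym_eq_one ha.one_lt hda (Int.natCast_dvd.mpr h)
  have hsqD : Squarefree D := by
    refine Int.squarefree_natAbs.mp ?_
    rw [hDabs]
    have hcop₁ : Nat.Coprime ℓ₀ a := (Nat.coprime_primes hℓ₀ ha).mpr haℓ.symm
    have hcop₂ : Nat.Coprime (ℓ₀ * a) d₁.natAbs :=
      Nat.Coprime.mul_left ((Nat.Prime.coprime_iff_not_dvd hℓ₀).mpr hℓ₀d₁) ((Nat.Prime.coprime_iff_not_dvd ha).mpr had₁)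
    refine (Nat.squarefree_mul hcop₂).mpr ⟨(Nat.squarefree_mul hcop₁).mpr ⟨hℓ₀.prime.squarefree, ha.prime.squarefree⟩, ?_⟩
    exact Int.squarefree_natAbs.mpr hsq₁
  have hD1 : D ≠ 1 := by omega
  -- Kronecker conditions at the primes that must SPLIT: `2`, `p`, the odd bad primes `≠ ℓ₀`
  set N₁ : ℕ := 2 * p * M with hN₁
  have hkr : ∀ r : ℕ, r.Prime → r ∣ N₁ → (r = 2 → D % 8 = 1) ∧ (r ≠ 2 → jacobiSym D r = 1) := by
    intro r hr hrN₁
    refine ⟨fun _ ↦ hD8, fun hr2 ↦ ?_⟩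
    have hj : jacobiSym D₀ r = 1 ∧ jacobiSym d₁ r = 1 := by
      rcases (Nat.Prime.dvd_mul hr).mp hrN₁ with h | hrM
      · rcases (Nat.Prime.dvd_mul hr).mp h with h2 | hrp
        · exact absurd ((Nat.prime_dvd_prime_iff_eq hr Nat.prime_two).mp h2) hr2
        · have hrp' : r = p := (Nat.prime_dvd_prime_iff_eq hr hp).mp hrp
          rw [hrp']
          refine ⟨?_, hdp⟩
          rw [hD₀, jacobiSym.mul_left, hJp, hJsq p hp (Ne.symm hℓ₀p)]
      · obtain ⟨hrN, -, hrℓ⟩ := hMmem r hr hrM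
        exact ⟨hjac₀ r hr hrN hr2 hrℓ, hdbad r hr hrN hr2 hrℓ⟩
    rw [hDdef, jacobiSym.mul_left, hj.1, hj.2, mul_one]
  -- `P(D)`: `ℓ₀ ∣ D`, the CLASS, and the simple zero of `L(E^{(D)}, s) = L(E''^{(d₁)}, s)` at `s = 1`
  have hℓ₀D : (ℓ₀ : ℤ) ∣ D := by
    rw [hDdef, hD₀eq]; exact (dvd_mul_right (ℓ₀ : ℤ) a).mul_right _
  have hDdiv : D / primeStar ℓ₀ = as * d₁ := by
    rw [hps, hDdef, hD₀, mul_assoc, Int.mul_ediv_cancel_left _ hs0]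
  have hclassD : legendreSym ℓ₀ (D / primeStar ℓ₀) = c := by
    rw [hDdiv, legendreSym.mul, jacobiSym.legendreSym.to_jacobiSym, jacobiSym.legendreSym.to_jacobiSym, hJℓ₀, hdℓ₀, mul_one]
  have hfun : (W.quadraticTwist (D : ℚ)).entireLFunction = ((W.quadraticTwist (D₀ : ℚ)).quadraticTwist (d₁ : ℚ)).entireLFunction := by
    rw [quadraticTwist_quadraticTwist, hDdef, Int.cast_mul]
  have hLD1 : (W.quadraticTwist (D : ℚ)).entireLFunction 1 ≠ 0 := by rw [hfun]; exact hL1₁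
  -- §4 the dictionary, backwards: the twisted road field `K`
  obtain ⟨K, iF, iN, hK, hB', hH, hℓ₀K, hclsK, hLK1⟩ :=
    (exists_heegnerField_iff_exists_fundamental N₁ (B + 4)
      (fun X ↦ (ℓ₀ : ℤ) ∣ X ∧ legendreSym ℓ₀ (X / primeStar ℓ₀) = c ∧
        (W.quadraticTwist (X : ℚ)).entireLFunction 1 ≠ 0)).mpr
      ⟨D, hDneg, Or.inl ⟨hD4, hsqD, hD1⟩, hBD, hkr, hℓ₀D, hclassD, hLD1⟩
  have h2N₁ : 2 ∣ N₁ := ⟨p * M, by rw [hN₁]; ring⟩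
  have hpN₁ : p ∣ N₁ := ⟨2 * M, by rw [hN₁]; ring⟩
  have hdKabs : ((NumberField.discr K).natAbs : ℤ) = -NumberField.discr K := by
    rw [Int.natCast_natAbs, abs_of_neg hK.discr_neg]
  refine ⟨K, iF, iN, ⟨hK, by omega, ⟨hℓ₀p, hℓ₀2, hadd₀, hmult₀⟩, ⟨hℓ₀K, hclsK⟩, ?_, fun _ ↦ by simpa using hH 2 Nat.prime_two h2N₁,
    hH.of_dvd hpN₁⟩, by omega, hLK1⟩
  -- every bad prime `≠ ℓ₀` splits in `K`
  intro r hr hrN hrℓ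
  by_cases hr2 : r = 2
  · subst hr2; exact hH 2 Nat.prime_two h2N₁
  · exact hH r hr ((hMdvd r hr hrN hr2 hrℓ).trans ⟨2 * p, by rw [hN₁]; ring⟩)

end Summit.BirchSwinnertonDyer.BirchSwinnertonDyer.Theorems.TwistedWanRoad

end
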